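/-
Copyright (c) 2026. All rights reserved.
Released under Apache 2.0 license as described in the file LICENSE.
Authors: abc-iut cell, wave-5 prover seat abc-iut-w5-d009 (gen 4).
-/
import Mathlib.AlgebraicGeometry.EllipticCurve.ModelsWithJ
import Mathlib.NumberTheory.Height.NumberField
import Literature.NumberTheory.DiophantineGeometry.GenEllMellProofs
import HarnessLib

/-!
# [GenEll] Prop. 3.4: the range of `ε` — kernel closure census of the fact-list row `prop34Ineq`

Mochizuki, *Arithmetic elliptic curves in general position*, Math. J. Okayama Univ. 52 (2010)
(`MochizukiGenEll2010`), Prop. 3.4 p. 17: for `ε ∈ ℝ_{>0}`,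
`deg_∞ ≲ ht_∞ ≲ 12(1+ε)·ht^Falt ≲ (1+ε)·ht_∞` on `M_ell(Q̄)`.

PROOF-ONLY file.  The tree states the displayed inequalities as the predicate `prop34Ineq ε`
(`GenEllMell.lean`) and PROVES them on the printed range: `prop34Ineq_of_pos : 0 < ε → prop34Ineq ε`
(`GenEllMellProofs.lean`, over the tree's theorem `silverman1986_jHeight_faltingsHeight_holds`).
The frozen fact list of cell abc-iut carries `prop34Ineq` as a row (F-2759) whose *universal closure*
`∀ ε, prop34Ineq ε` was handed to a fact-proving seat (plan/F-TRANCHES.tsv, tranche 180).  This file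
closes the bookkeeping in the kernel: the universal closure is FALSE — at `ε = −1` the middle relation
reads "`ht_∞` is bounded above on `M_ell(Q̄)`", refuted by the `ℚ`-curves with `j`-invariant
`n = 1, 2, 3, …` (Mathlib's `WeierstrassCurve.ofJ`), whose `ht_∞` is `log n` (Mathlib's
`Rat.logHeight₁_natCast`).  So F-2759 is PROVED on its printed range and REFUTED outside it; there is
nothing left to prove.  Classical; no bearing on, and no side taken on, [IUTchIII] Cor. 3.12.
-/

noncomputable section

namespace Literature.NumberTheory.DiophantineGeometry.GenEll

/-- `ht_∞` of the `ℚ`-curve with `j`-invariant `n ∈ ℕ_{>0}` (Mathlib's model `ofJ n`, presented over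
`ℚ`) is `log n`: `[ℚ:ℚ] = 1` and `h(n) = log n`. [cite: MochizukiGenEll2010, §3 p.16] -/
theorem htInf_ofJ_natCast (n : ℕ) [NeZero n] :
    (EllPoint.mk ℚ (WeierstrassCurve.ofJ (n : ℚ))).htInf = Real.log n := by
  unfold EllPoint.htInf EllPoint.degree
  rw [WeierstrassCurve.ofJ_j, Rat.logHeight₁_natCast]
  simp [Module.finrank_self]

/-- **`prop34Ineq (−1)` is false**: its middle relation `ht_∞ ≲ 12·(1 + (−1))·ht^Falt = 0` would
bound `ht_∞` on `M_ell(Q̄)`, but `ht_∞(E) = log j(E)` is unbounded along the `ℚ`-curves `ofJ n`.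
[cite: MochizukiGenEll2010, Prop 3.4 p.17] -/
theorem not_prop34Ineq_neg_one : ¬ prop34Ineq (-1) := by
  rintro ⟨-, ⟨C, hC⟩, -⟩
  obtain ⟨n, hn⟩ : ∃ n : ℕ, Real.exp C < n := exists_nat_gt _
  have hnpos : (0 : ℝ) < n := (Real.exp_pos C).trans hn
  haveI : NeZero n := ⟨by exact_mod_cast hnpos.ne'⟩
  have h := hC (EllPoint.mk ℚ (WeierstrassCurve.ofJ (n : ℚ))) (Set.mem_univ _)
  rw [htInf_ofJ_natCast] at h
  have hlog : C < Real.log n := (Real.lt_log_iff_exp_lt hnpos).2 hn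
  norm_num at h
  linarith

/-- Hence the UNIVERSAL CLOSURE of the fact-list row F-2759 is false; the printed statement
(`ε > 0`) is the tree's theorem `prop34Ineq_of_pos`. [cite: MochizukiGenEll2010, Prop 3.4 p.17] -/
theorem not_forall_prop34Ineq : ¬ ∀ ε : ℝ, prop34Ineq ε := fun h => not_prop34Ineq_neg_one (h _)

/-- The exact range, for the record: `prop34Ineq ε` holds for every `ε > 0` (tree) and fails at
`ε = −1` (above). [cite: MochizukiGenEll2010, Prop 3.4 p.17] -/
theorem prop34Ineq_pos_and_not_neg_one : (∀ ε : ℝ, 0 < ε → prop34Ineq ε) ∧ ¬ prop34Ineq (-1) :=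
  ⟨fun _ hε => prop34Ineq_of_pos hε, not_prop34Ineq_neg_one⟩

end Literature.NumberTheory.DiophantineGeometry.GenEll

end
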